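import Summits.CriticalPhenomena.SAWScalingLimit.Theorems.SAWDevelopingMapHexConjectureFloorRatioAssembly
import Summits.CriticalPhenomena.SAWScalingLimit.Theorems.HexConjecture.Negative.NonVacuity
import Summits.CriticalPhenomena.SAWScalingLimit.Theses.SAWHexUniversality
import HarnessLib

/-!
# Crux `HexConjecture` (stmt-CriticalPhenomena-0808), line `root-locality-replaces-loewner`:
ONE residual for two cruxes — the floor class with floor-vertex endpoints, and boundary universality

Landing target:
`Summits/CriticalPhenomena/SAWScalingLimit/Theorems/SAWDevelopingMapHexConjectureBoundaryUniversality.lean`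
(`--supports stmt-CriticalPhenomena-0808`; lead continuation prover-line-stmt-CriticalPhenomena-0808-c2-0).

The line's skeleton (`Cruxes/HexConjecture/Lines/root_locality_replaces_loewner.lean`) reaches the crux on the FLOOR
class with DISCRETE-BOUNDARY lattice endpoints (`HexConjectureFloor`: eventually `a δ, b δ ∈ Ω_δ` with a honeycomb
neighbour whose `Ω_δ`-edge is missing) and leaves the residual stub `stub_marksAndEndpointsFloor :
HexConjectureFloor → HexConjecture`.  Crux stmt-CriticalPhenomena-10472 (`ObservableToSLE`), whose three lines all died
at their W2 stubs, states its residual over the floor class with FLOOR-VERTEX endpoints (a honeycomb neighbour on or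
below the floor line; `Cruxes/ObservableToSLE/Restatement.lean`, (E) `BoundaryUniversality`).  This file proves that
the two classes of endpoint approximations COINCIDE eventually on floor domains, hence:

* `floorConvergence_iff_hexConjectureFloor` — the two floor-class convergence statements are equivalent;
* `boundaryUniversality_iff_marksAndEndpointsFloor` — 10472's (E) and this line's stub 7♭ are equivalent: the two
  cruxes expose ONE residual statement to the planners;
* `hexConjecture_iff_floorConvergence_and_boundaryUniversality` — the crux is (floor-class convergence) ∧ (E);
* `floorConvergence_of_boundaryEstimates` — floor-class convergence (10472's class) from the three boundary /
  regularity estimates `FloorRatioLimit` (⟸ stmt-14003, `floorRatioModulus_of_hexObservableLimit`),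
  `HalfPlaneArchTightness`, `UniformModulus` (the last two verbatim crux-10472's registered stubs), no tightness input;
* `hexConjecture_of_boundaryEstimates` — the four-hypothesis composition the reshaped skeleton (v4) registers;
* `hexConjecture_of_items` — the same with `FloorRatioLimit` discharged from item stmt-14003 (`HexObservableLimitR`): crux 0808 as an
  assembly over {stmt-14003, HPAT, UIM, (E)}.
-/

noncomputable section

open scoped Topology NNReal ENNReal
open Filter Set Metric MeasureTheory
open Literature.Probability.LatticeModels (HexVertex hexGraph hexCenter)
open Literature.Probability.RandomPlanarGeometry
open Literature.Probability.RandomPlanarGeometry.SAW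
open Summit.CriticalPhenomena.SAWScalingLimit.Theorems.ObservableToSLE.FloorRatio (eventually_adj_mem_ball)
open Summit.CriticalPhenomena.SAWScalingLimit.Cruxes.HexConjecture (NonVacuity.IsEmbEndpointApprox.eventually_ne)

namespace Summit.CriticalPhenomena.SAWScalingLimit.Theorems.HexConjecture.RootLocality

/-! ### The two endpoint classes coincide on floor domains -/

/-- In a domain lying above the horizontal line `im z = h`, no `Ω_δ`-edge reaches a vertex whose rescaled centre is on
or below that line (its endpoint would be a vertex of `Ω_δ`, hence inside `Ω`). [folklore] -/
theorem not_hexDomainGraph_adj_of_im_le {Ω : Set ℂ} {h : ℝ} (hΩ : Ω ⊆ {z : ℂ | h < z.im}) {δ : ℝ}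
    {v u : HexVertex} (hu : ((δ : ℂ) * hexCenter u).im ≤ h) : ¬ (hexDomainGraph Ω δ).Adj v u := by
  intro hadj
  have huΩ : u ∈ embMeshDomain hexGraph hexCenter Ω δ := ((embDomainGraph_adj_iff _ _).1 hadj).2.2
  have : h < ((δ : ℂ) * hexCenter u).im := hΩ (embMeshDomain_subset _ _ _ _ huΩ)
  exact absurd this (not_lt.2 hu)

/-- Distinct vertices joined in `Ω_δ` are vertices of `Ω_δ` (the first edge of a joining walk). [folklore] -/
theorem mem_embMeshDomain_of_reachable_ne {V : Type*} {G : SimpleGraph V} {emb : V → ℂ} {Ω : Set ℂ} {δ : ℝ}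
    {a b : V} (hab : a ≠ b) (h : (embDomainGraph G emb Ω δ).Reachable a b) : a ∈ embMeshDomain G emb Ω δ := by
  obtain ⟨p⟩ := h
  cases p with
  | nil => exact absurd rfl hab
  | cons hadj _ => exact ((embDomainGraph_adj_iff G emb).1 hadj).2.1

/-- **Floor-vertex endpoints are discrete-boundary endpoints** (floor domains): if `D` lies above the line through
its marks and the lattice endpoints have honeycomb neighbours on or below that line, then eventually they are vertices
of `Ω_δ` (they are joined and distinct) with a missing `Ω_δ`-edge (to that neighbour). [folklore] -/
theorem eventually_discreteBoundary_of_floorVertex {D : DobrushinDomain} {a b : ℝ → HexVertex}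
    (hD : D.carrier ⊆ {z : ℂ | (D.pt 0).im < z.im}) (h01 : (D.pt 1).im = (D.pt 0).im)
    (hab : IsEmbEndpointApprox hexGraph hexCenter D a b)
    (hfl : ∀ᶠ δ : ℝ in 𝓝[>] 0,
      (∃ u : HexVertex, hexGraph.Adj (a δ) u ∧ ((δ : ℂ) * hexCenter u).im ≤ (D.pt 0).im) ∧
      (∃ u : HexVertex, hexGraph.Adj (b δ) u ∧ ((δ : ℂ) * hexCenter u).im ≤ (D.pt 1).im)) :
    ∀ᶠ δ : ℝ in 𝓝[>] 0,
      (a δ ∈ embMeshDomain hexGraph hexCenter D.carrier δ ∧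
        ∃ w, hexGraph.Adj (a δ) w ∧ ¬ (hexDomainGraph D.carrier δ).Adj (a δ) w) ∧
      (b δ ∈ embMeshDomain hexGraph hexCenter D.carrier δ ∧
        ∃ w, hexGraph.Adj (b δ) w ∧ ¬ (hexDomainGraph D.carrier δ).Adj (b δ) w) := by
  filter_upwards [hfl, hab.reachable, NonVacuity.IsEmbEndpointApprox.eventually_ne hab] with δ hδ hreach hne
  obtain ⟨⟨u, hu, hui⟩, ⟨u', hu', hui'⟩⟩ := hδ
  rw [h01] at hui'
  exact ⟨⟨mem_embMeshDomain_of_reachable_ne hne hreach, u, hu, not_hexDomainGraph_adj_of_im_le hD hui⟩,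
    ⟨mem_embMeshDomain_of_reachable_ne (Ne.symm hne) hreach.symm, u', hu', not_hexDomainGraph_adj_of_im_le hD hui'⟩⟩

/-- **Discrete-boundary endpoints are floor-vertex endpoints** (floor domains): inside the flat balls a vertex of `Ω_δ`
with a missing `Ω_δ`-edge to a honeycomb neighbour has that neighbour on or below the floor line
(`stub_avoidanceCocycle_floorEndpoint`), and the endpoints with their neighbours are eventually inside the balls
(`eventually_adj_mem_ball`). [folklore] -/
theorem eventually_floorVertex_of_discreteBoundary {D : DobrushinDomain} {ρ : ℝ} {a b : ℝ → HexVertex} (hρ : 0 < ρ)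
    (hflat0 : D.carrier ∩ ball (D.pt 0) ρ = {z : ℂ | (D.pt 0).im < z.im} ∩ ball (D.pt 0) ρ)
    (hflat1 : D.carrier ∩ ball (D.pt 1) ρ = {z : ℂ | (D.pt 1).im < z.im} ∩ ball (D.pt 1) ρ)
    (hab : IsEmbEndpointApprox hexGraph hexCenter D a b)
    (hbd : ∀ᶠ δ : ℝ in 𝓝[>] 0,
      (a δ ∈ embMeshDomain hexGraph hexCenter D.carrier δ ∧
        ∃ w, hexGraph.Adj (a δ) w ∧ ¬ (hexDomainGraph D.carrier δ).Adj (a δ) w) ∧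
      (b δ ∈ embMeshDomain hexGraph hexCenter D.carrier δ ∧
        ∃ w, hexGraph.Adj (b δ) w ∧ ¬ (hexDomainGraph D.carrier δ).Adj (b δ) w)) :
    ∀ᶠ δ : ℝ in 𝓝[>] 0,
      (∃ u : HexVertex, hexGraph.Adj (a δ) u ∧ ((δ : ℂ) * hexCenter u).im ≤ (D.pt 0).im) ∧
      (∃ u : HexVertex, hexGraph.Adj (b δ) u ∧ ((δ : ℂ) * hexCenter u).im ≤ (D.pt 1).im) := by
  filter_upwards [hbd, eventually_adj_mem_ball hρ hab.tendsto_fst,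
    eventually_adj_mem_ball hρ hab.tendsto_snd] with δ h hBa hBb
  obtain ⟨⟨haΩ, wa, hwa, hna⟩, ⟨hbΩ, wb, hwb, hnb⟩⟩ := h
  exact ⟨⟨wa, hwa, stub_avoidanceCocycle_floorEndpoint _ _ _ _ _ _ hflat0 (hBa _ (Or.inl rfl))
      (hBa _ (Or.inr hwa)) haΩ hwa hna⟩,
    ⟨wb, hwb, stub_avoidanceCocycle_floorEndpoint _ _ _ _ _ _ hflat1 (hBb _ (Or.inl rfl))
      (hBb _ (Or.inr hwb)) hbΩ hwb hnb⟩⟩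

/-! ### The two floor-class convergence statements, and the residual, coincide -/

/-- **Floor-class convergence: floor-vertex endpoints (crux-10472's class, `Restatement.FloorObservableToSLE`'s
conclusion / (E)'s hypothesis) ⟺ discrete-boundary endpoints (this line's `HexConjectureFloor`).** [folklore] -/
theorem floorConvergence_iff_hexConjectureFloor :
    (∀ (D : DobrushinDomain) (ρ : ℝ) (a b : ℝ → HexVertex),
      (0 < ρ ∧ (D.pt 1).im = (D.pt 0).im ∧ D.carrier ⊆ {z : ℂ | (D.pt 0).im < z.im} ∧
        D.carrier ∩ ball (D.pt 0) ρ = {z : ℂ | (D.pt 0).im < z.im} ∩ ball (D.pt 0) ρ ∧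
        D.carrier ∩ ball (D.pt 1) ρ = {z : ℂ | (D.pt 1).im < z.im} ∩ ball (D.pt 1) ρ) →
      (IsEmbEndpointApprox hexGraph hexCenter D a b ∧ ∀ᶠ δ : ℝ in 𝓝[>] 0,
        (∃ u : HexVertex, hexGraph.Adj (a δ) u ∧ ((δ : ℂ) * hexCenter u).im ≤ (D.pt 0).im) ∧
        (∃ u : HexVertex, hexGraph.Adj (b δ) u ∧ ((δ : ℂ) * hexCenter u).im ≤ (D.pt 1).im)) →
      ConvergesInLawToSLE ((8 : ℝ≥0) / 3) D
        (fun δ (γ : HexDomainSAW D.carrier δ (a δ) (b δ)) => γ.curve)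
        (fun δ => hexSAWLaw D.carrier δ (a δ) (b δ))) ↔
    (∀ (D : DobrushinDomain) (ρ : ℝ) (a b : ℝ → HexVertex),
      (0 < ρ ∧ (D.pt 1).im = (D.pt 0).im ∧ D.carrier ⊆ {z : ℂ | (D.pt 0).im < z.im} ∧
        D.carrier ∩ ball (D.pt 0) ρ = {z : ℂ | (D.pt 0).im < z.im} ∩ ball (D.pt 0) ρ ∧
        D.carrier ∩ ball (D.pt 1) ρ = {z : ℂ | (D.pt 1).im < z.im} ∩ ball (D.pt 1) ρ) →
      IsEmbEndpointApprox hexGraph hexCenter D a b →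
      (∀ᶠ δ : ℝ in 𝓝[>] 0,
        (a δ ∈ embMeshDomain hexGraph hexCenter D.carrier δ ∧
          ∃ w, hexGraph.Adj (a δ) w ∧ ¬ (hexDomainGraph D.carrier δ).Adj (a δ) w) ∧
        (b δ ∈ embMeshDomain hexGraph hexCenter D.carrier δ ∧
          ∃ w, hexGraph.Adj (b δ) w ∧ ¬ (hexDomainGraph D.carrier δ).Adj (b δ) w)) →
      ConvergesInLawToSLE ((8 : ℝ≥0) / 3) D
        (fun δ (γ : HexDomainSAW D.carrier δ (a δ) (b δ)) => γ.curve)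
        (fun δ => hexSAWLaw D.carrier δ (a δ) (b δ))) := by
  constructor
  · intro h D ρ a b hfl hab hbd
    exact h D ρ a b hfl ⟨hab, eventually_floorVertex_of_discreteBoundary hfl.1 hfl.2.2.2.1 hfl.2.2.2.2 hab hbd⟩
  · intro h D ρ a b hfl hend
    exact h D ρ a b hfl hend.1 (eventually_discreteBoundary_of_floorVertex hfl.2.2.1 hfl.2.1 hend.1 hend.2)

/-- **One residual for two cruxes**: crux-10472's (E) `BoundaryUniversality` (floor-class convergence with floor-vertex
endpoints ⟹ DCS Conjecture 1 as typed) is EQUIVALENT to this line's registered residual `stub_marksAndEndpointsFloor`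
(`HexConjectureFloor → HexConjecture`). [folklore] -/
theorem boundaryUniversality_iff_marksAndEndpointsFloor :
    ((∀ (D : DobrushinDomain) (ρ : ℝ) (a b : ℝ → HexVertex),
      (0 < ρ ∧ (D.pt 1).im = (D.pt 0).im ∧ D.carrier ⊆ {z : ℂ | (D.pt 0).im < z.im} ∧
        D.carrier ∩ ball (D.pt 0) ρ = {z : ℂ | (D.pt 0).im < z.im} ∩ ball (D.pt 0) ρ ∧
        D.carrier ∩ ball (D.pt 1) ρ = {z : ℂ | (D.pt 1).im < z.im} ∩ ball (D.pt 1) ρ) →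
      (IsEmbEndpointApprox hexGraph hexCenter D a b ∧ ∀ᶠ δ : ℝ in 𝓝[>] 0,
        (∃ u : HexVertex, hexGraph.Adj (a δ) u ∧ ((δ : ℂ) * hexCenter u).im ≤ (D.pt 0).im) ∧
        (∃ u : HexVertex, hexGraph.Adj (b δ) u ∧ ((δ : ℂ) * hexCenter u).im ≤ (D.pt 1).im)) →
      ConvergesInLawToSLE ((8 : ℝ≥0) / 3) D
        (fun δ (γ : HexDomainSAW D.carrier δ (a δ) (b δ)) => γ.curve)
        (fun δ => hexSAWLaw D.carrier δ (a δ) (b δ))) →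
      Summit.CriticalPhenomena.SAWScalingLimit.Theses.SAWHexUniversality.HexConjecture) ↔
    ((∀ (D : DobrushinDomain) (ρ : ℝ) (a b : ℝ → HexVertex),
      (0 < ρ ∧ (D.pt 1).im = (D.pt 0).im ∧ D.carrier ⊆ {z : ℂ | (D.pt 0).im < z.im} ∧
        D.carrier ∩ ball (D.pt 0) ρ = {z : ℂ | (D.pt 0).im < z.im} ∩ ball (D.pt 0) ρ ∧
        D.carrier ∩ ball (D.pt 1) ρ = {z : ℂ | (D.pt 1).im < z.im} ∩ ball (D.pt 1) ρ) →
      IsEmbEndpointApprox hexGraph hexCenter D a b →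
      (∀ᶠ δ : ℝ in 𝓝[>] 0,
        (a δ ∈ embMeshDomain hexGraph hexCenter D.carrier δ ∧
          ∃ w, hexGraph.Adj (a δ) w ∧ ¬ (hexDomainGraph D.carrier δ).Adj (a δ) w) ∧
        (b δ ∈ embMeshDomain hexGraph hexCenter D.carrier δ ∧
          ∃ w, hexGraph.Adj (b δ) w ∧ ¬ (hexDomainGraph D.carrier δ).Adj (b δ) w)) →
      ConvergesInLawToSLE ((8 : ℝ≥0) / 3) D
        (fun δ (γ : HexDomainSAW D.carrier δ (a δ) (b δ)) => γ.curve)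
        (fun δ => hexSAWLaw D.carrier δ (a δ) (b δ))) →
      Summit.CriticalPhenomena.SAWScalingLimit.Theses.SAWHexUniversality.HexConjecture) :=
  Iff.imp floorConvergence_iff_hexConjectureFloor Iff.rfl

/-- The crux contains the floor class (floor-vertex endpoints): (E)'s hypothesis is an honest special case. [folklore] -/
theorem floorConvergence_of_hexConjecture (h : Summit.CriticalPhenomena.SAWScalingLimit.Theses.SAWHexUniversality.HexConjecture) :
    ∀ (D : DobrushinDomain) (ρ : ℝ) (a b : ℝ → HexVertex),
      (0 < ρ ∧ (D.pt 1).im = (D.pt 0).im ∧ D.carrier ⊆ {z : ℂ | (D.pt 0).im < z.im} ∧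
        D.carrier ∩ ball (D.pt 0) ρ = {z : ℂ | (D.pt 0).im < z.im} ∩ ball (D.pt 0) ρ ∧
        D.carrier ∩ ball (D.pt 1) ρ = {z : ℂ | (D.pt 1).im < z.im} ∩ ball (D.pt 1) ρ) →
      (IsEmbEndpointApprox hexGraph hexCenter D a b ∧ ∀ᶠ δ : ℝ in 𝓝[>] 0,
        (∃ u : HexVertex, hexGraph.Adj (a δ) u ∧ ((δ : ℂ) * hexCenter u).im ≤ (D.pt 0).im) ∧
        (∃ u : HexVertex, hexGraph.Adj (b δ) u ∧ ((δ : ℂ) * hexCenter u).im ≤ (D.pt 1).im)) →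
      ConvergesInLawToSLE ((8 : ℝ≥0) / 3) D
        (fun δ (γ : HexDomainSAW D.carrier δ (a δ) (b δ)) => γ.curve)
        (fun δ => hexSAWLaw D.carrier δ (a δ) (b δ)) :=
  fun D _ a b _ hend => h D a b hend.1

/-- **The assembly shape of the crux**: DCS Conjecture 1 as typed ⟺ (its floor class, floor-vertex endpoints) ∧
(boundary universality (E)).  The first conjunct is a theorem modulo `FloorRatioLimit` (⟸ stmt-14003) + `HalfPlaneArchTightness`
+ `UniformModulus` (`floorConvergence_of_boundaryEstimates`); the second is the residual shared with crux-10472. [folklore] -/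
theorem hexConjecture_iff_floorConvergence_and_boundaryUniversality :
    Summit.CriticalPhenomena.SAWScalingLimit.Theses.SAWHexUniversality.HexConjecture ↔
    ((∀ (D : DobrushinDomain) (ρ : ℝ) (a b : ℝ → HexVertex),
      (0 < ρ ∧ (D.pt 1).im = (D.pt 0).im ∧ D.carrier ⊆ {z : ℂ | (D.pt 0).im < z.im} ∧
        D.carrier ∩ ball (D.pt 0) ρ = {z : ℂ | (D.pt 0).im < z.im} ∩ ball (D.pt 0) ρ ∧
        D.carrier ∩ ball (D.pt 1) ρ = {z : ℂ | (D.pt 1).im < z.im} ∩ ball (D.pt 1) ρ) →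
      (IsEmbEndpointApprox hexGraph hexCenter D a b ∧ ∀ᶠ δ : ℝ in 𝓝[>] 0,
        (∃ u : HexVertex, hexGraph.Adj (a δ) u ∧ ((δ : ℂ) * hexCenter u).im ≤ (D.pt 0).im) ∧
        (∃ u : HexVertex, hexGraph.Adj (b δ) u ∧ ((δ : ℂ) * hexCenter u).im ≤ (D.pt 1).im)) →
      ConvergesInLawToSLE ((8 : ℝ≥0) / 3) D
        (fun δ (γ : HexDomainSAW D.carrier δ (a δ) (b δ)) => γ.curve)
        (fun δ => hexSAWLaw D.carrier δ (a δ) (b δ))) ∧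
     ((∀ (D : DobrushinDomain) (ρ : ℝ) (a b : ℝ → HexVertex),
      (0 < ρ ∧ (D.pt 1).im = (D.pt 0).im ∧ D.carrier ⊆ {z : ℂ | (D.pt 0).im < z.im} ∧
        D.carrier ∩ ball (D.pt 0) ρ = {z : ℂ | (D.pt 0).im < z.im} ∩ ball (D.pt 0) ρ ∧
        D.carrier ∩ ball (D.pt 1) ρ = {z : ℂ | (D.pt 1).im < z.im} ∩ ball (D.pt 1) ρ) →
      (IsEmbEndpointApprox hexGraph hexCenter D a b ∧ ∀ᶠ δ : ℝ in 𝓝[>] 0,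
        (∃ u : HexVertex, hexGraph.Adj (a δ) u ∧ ((δ : ℂ) * hexCenter u).im ≤ (D.pt 0).im) ∧
        (∃ u : HexVertex, hexGraph.Adj (b δ) u ∧ ((δ : ℂ) * hexCenter u).im ≤ (D.pt 1).im)) →
      ConvergesInLawToSLE ((8 : ℝ≥0) / 3) D
        (fun δ (γ : HexDomainSAW D.carrier δ (a δ) (b δ)) => γ.curve)
        (fun δ => hexSAWLaw D.carrier δ (a δ) (b δ))) →
      Summit.CriticalPhenomena.SAWScalingLimit.Theses.SAWHexUniversality.HexConjecture)) :=
  ⟨fun h => ⟨floorConvergence_of_hexConjecture h, fun _ => h⟩, fun h => h.2 h.1⟩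

/-! ### The floor class (10472's endpoint convention) from the three estimates -/

/-- **Floor-class convergence with floor-vertex endpoints from the three boundary / regularity estimates**:
`FloorRatioLimit` (boundary partition-function ratios `Z_δ(a→b')/Z_δ(a→b) → |Φ'(b')/Φ'(b)|^{5/8}`; implied by DCS
Conjecture 2 = stmt-14003), `HalfPlaneArchTightness` and `UniformModulus` (verbatim crux-10472's registered stubs) give
convergence in law of the critical hexagonal SAW to chordal SLE(8/3) on every floor domain with floor-vertex
endpoints — crux-10472's narrowed statement (C′) WITHOUT its hypotheses `HexObservableLimit`'s bulk values and
`HexTight`.  (`hexConjectureFloor_of_boundaryEstimates`, p117152, read through `floorConvergence_iff_hexConjectureFloor`.)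
[cite: LawlerSchrammWerner2004SAW, §3.4 ("SAW satisfies restriction") and Prop. 2] -/
theorem floorConvergence_of_boundaryEstimates
    (hF : ∀ (D D' : DobrushinDomain) (ρ : ℝ) (Λ : ℝ → Finset HexVertex) (m₀ m m' : ℝ → ℤ) (a b b' : ℝ → Sym2 HexVertex) (Φ : ConformalEquiv D.carrier UpperHalfPlane.upperHalfPlaneSet) (L : ℂ → ℂ) (Lb Lb' : ℂ), D'.carrier = D.carrier → D'.pt 0 = D.pt 0 → 0 < ρ → D.carrier ∩ Metric.ball (D.pt 0) ρ = {z : ℂ | (D.pt 0).im < z.im} ∩ Metric.ball (D.pt 0) ρ → D.carrier ∩ Metric.ball (D.pt 1) ρ = {z : ℂ | (D.pt 1).im < z.im} ∩ Metric.ball (D.pt 1) ρ → D.carrier ∩ Metric.ball (D'.pt 1) ρ = {z : ℂ | (D'.pt 1).im < z.im} ∩ Metric.ball (D'.pt 1) ρ → (∀ᶠ δ : ℝ in 𝓝[>] 0, hexDomainSimplyConnected (Λ δ) ∧ a δ ∈ hexDomainBoundary (Λ δ) ∧ b δ ∈ hexDomainBoundary (Λ δ) ∧ b' δ ∈ hexDomainBoundary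 (Λ δ) ∧ Nonempty (HexMidEdgeSAW (Λ δ) (a δ) (b δ)) ∧ Nonempty (HexMidEdgeSAW (Λ δ) (a δ) (b' δ)) ∧ (hexGraph.induce (↑(Λ δ) : Set HexVertex)).Preconnected ∧ (∀ v ∈ Λ δ, (δ : ℂ) * hexCenter v ∈ D.carrier) ∧ (∀ v : HexVertex, (δ : ℂ) * hexCenter v ∈ Metric.ball (D.pt 0) ρ → (v ∈ Λ δ ↔ m₀ δ ≤ v.1 1)) ∧ (∀ v : HexVertex, (δ : ℂ) * hexCenter v ∈ Metric.ball (D.pt 1) ρ → (v ∈ Λ δ ↔ m δ ≤ v.1 1)) ∧ (∀ v : HexVertex, (δ : ℂ) * hexCenter v ∈ Metric.ball (D'.pt 1) ρ → (v ∈ Λ δ ↔ m' δ ≤ v.1 1))) → (∀ K : Set ℂ, IsCompact K → K ⊆ D.carrier → ∀ᶠ δ : ℝ in 𝓝[>] 0, ∀ v : HexVertex, (δ : ℂ) * hexCenter v ∈ K → v ∈ Λ δ) → Tendsto (fun δ : ℝ => (δ : ℂ) * hexMidpoint (a δ)) (𝓝[>] 0) (𝓝 (D.pt 0)) → Tendsto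 (fun δ : ℝ => (δ : ℂ) * hexMidpoint (b δ)) (𝓝[>] 0) (𝓝 (D.pt 1)) → Tendsto (fun δ : ℝ => (δ : ℂ) * hexMidpoint (b' δ)) (𝓝[>] 0) (𝓝 (D'.pt 1)) → Tendsto (fun x => ‖Φ x‖) (𝓝[D.carrier] (D.pt 0)) Filter.atTop → Φ.HasBoundaryValue (D.pt 1) 0 → ContinuousOn L D.carrier → (∀ z ∈ D.carrier, Complex.exp (L z) = deriv Φ z) → Tendsto L (𝓝[D.carrier] (D.pt 1)) (𝓝 Lb) → Tendsto L (𝓝[D.carrier] (D'.pt 1)) (𝓝 Lb') → Tendsto (fun δ : ℝ => ‖hexParafermionicObservable (Λ δ) (a δ) hexCriticalFugacity (5 / 8) (b' δ) / hexParafermionicObservable (Λ δ) (a δ) hexCriticalFugacity (5 / 8) (b δ)‖) (𝓝[>] 0) (𝓝 (Real.exp ((5 / 8) * (Lb' - Lb).re))))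
    (hT : ∀ ε : ℝ, 0 < ε → ∃ K : ℝ, 0 < K ∧ ∀ (n : ℕ), 1 ≤ n → ∀ (Λ B : Finset HexVertex)
    (s t : Sym2 HexVertex), s ∈ hexDomainBoundary Λ → t ∈ hexDomainBoundary Λ → s ≠ t →
    dist (hexMidpoint s) (hexMidpoint t) ≤ n → (hexMidpoint t).im = (hexMidpoint s).im →
    (∀ v ∈ Λ, (hexMidpoint s).im < (hexCenter v).im) →
    (∀ v : HexVertex, v ∈ B ↔ ((hexMidpoint s).im < (hexCenter v).im ∧
      dist (hexCenter v) (hexMidpoint s) ≤ 2 * K * n)) →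
    (∑ γ : HexMidEdgeSAW Λ s t, if ∃ v ∈ γ.verts, K * n ≤ dist (hexCenter v) (hexMidpoint s)
      then hexCriticalFugacity ^ γ.length else 0) ≤
    ε * ∑ γ : HexMidEdgeSAW B s t, hexCriticalFugacity ^ γ.length)
    (hU : ∀ (D : DobrushinDomain) (ρ : ℝ) (a b : ℝ → HexVertex),
      (0 < ρ ∧ (D.pt 1).im = (D.pt 0).im ∧ D.carrier ⊆ {z : ℂ | (D.pt 0).im < z.im} ∧
      D.carrier ∩ ball (D.pt 0) ρ = {z : ℂ | (D.pt 0).im < z.im} ∩ ball (D.pt 0) ρ ∧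
      D.carrier ∩ ball (D.pt 1) ρ = {z : ℂ | (D.pt 1).im < z.im} ∩ ball (D.pt 1) ρ) →
      (IsEmbEndpointApprox hexGraph hexCenter D a b ∧ ∀ᶠ δ : ℝ in 𝓝[>] 0,
      (∃ u : HexVertex, hexGraph.Adj (a δ) u ∧ ((δ : ℂ) * hexCenter u).im ≤ (D.pt 0).im) ∧
      (∃ u : HexVertex, hexGraph.Adj (b δ) u ∧ ((δ : ℂ) * hexCenter u).im ≤ (D.pt 1).im)) →
      ∀ ε η : ℝ, 0 < ε → 0 < η → ∃ θ : ℝ, 0 < θ ∧ ∀ᶠ δ : ℝ in 𝓝[>] 0,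
        hexSAWLaw D.carrier δ (a δ) (b δ) {γ | γ.curve ∉ CurveClass.modulusClass ε θ} ≤
          ENNReal.ofReal η) :
    ∀ (D : DobrushinDomain) (ρ : ℝ) (a b : ℝ → HexVertex),
      (0 < ρ ∧ (D.pt 1).im = (D.pt 0).im ∧ D.carrier ⊆ {z : ℂ | (D.pt 0).im < z.im} ∧
        D.carrier ∩ ball (D.pt 0) ρ = {z : ℂ | (D.pt 0).im < z.im} ∩ ball (D.pt 0) ρ ∧
        D.carrier ∩ ball (D.pt 1) ρ = {z : ℂ | (D.pt 1).im < z.im} ∩ ball (D.pt 1) ρ) →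
      (IsEmbEndpointApprox hexGraph hexCenter D a b ∧ ∀ᶠ δ : ℝ in 𝓝[>] 0,
        (∃ u : HexVertex, hexGraph.Adj (a δ) u ∧ ((δ : ℂ) * hexCenter u).im ≤ (D.pt 0).im) ∧
        (∃ u : HexVertex, hexGraph.Adj (b δ) u ∧ ((δ : ℂ) * hexCenter u).im ≤ (D.pt 1).im)) →
      ConvergesInLawToSLE ((8 : ℝ≥0) / 3) D
        (fun δ (γ : HexDomainSAW D.carrier δ (a δ) (b δ)) => γ.curve)
        (fun δ => hexSAWLaw D.carrier δ (a δ) (b δ)) :=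
  floorConvergence_iff_hexConjectureFloor.2 (hexConjectureFloor_of_boundaryEstimates hF hT hU)

/-- **The reshaped composition of the line (skeleton v4)**: floor-ratio limit + half-plane arch tightness + uniform
injectivity modulus + boundary universality (E) ⟹ DCS Conjecture 1 as typed (`SAWHexUniversality.HexConjecture`).
[cite: LawlerSchrammWerner2004SAW, §3.4 and Prop. 2] -/
theorem hexConjecture_of_boundaryEstimates
    (hF : ∀ (D D' : DobrushinDomain) (ρ : ℝ) (Λ : ℝ → Finset HexVertex) (m₀ m m' : ℝ → ℤ) (a b b' : ℝ → Sym2 HexVertex) (Φ : ConformalEquiv D.carrier UpperHalfPlane.upperHalfPlaneSet) (L : ℂ → ℂ) (Lb Lb' : ℂ), D'.carrier = D.carrier → D'.pt 0 = D.pt 0 → 0 < ρ → D.carrier ∩ Metric.ball (D.pt 0) ρ = {z : ℂ | (D.pt 0).im < z.im} ∩ Metric.ball (D.pt 0) ρ → D.carrier ∩ Metric.ball (D.pt 1) ρ = {z : ℂ | (D.pt 1).im < z.im} ∩ Metric.ball (D.pt 1) ρ → D.carrier ∩ Metric.ball (D'.pt 1) ρ = {z : ℂ | (D'.pt 1).im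 < z.im} ∩ Metric.ball (D'.pt 1) ρ → (∀ᶠ δ : ℝ in 𝓝[>] 0, hexDomainSimplyConnected (Λ δ) ∧ a δ ∈ hexDomainBoundary (Λ δ) ∧ b δ ∈ hexDomainBoundary (Λ δ) ∧ b' δ ∈ hexDomainBoundary (Λ δ) ∧ Nonempty (HexMidEdgeSAW (Λ δ) (a δ) (b δ)) ∧ Nonempty (HexMidEdgeSAW (Λ δ) (a δ) (b' δ)) ∧ (hexGraph.induce (↑(Λ δ) : Set HexVertex)).Preconnected ∧ (∀ v ∈ Λ δ, (δ : ℂ) * hexCenter v ∈ D.carrier) ∧ (∀ v : HexVertex, (δ : ℂ) * hexCenter v ∈ Metric.ball (D.pt 0) ρ → (v ∈ Λ δ ↔ m₀ δ ≤ v.1 1)) ∧ (∀ v : HexVertex, (δ : ℂ) * hexCenter v ∈ Metric.ball (D.pt 1) ρ → (v ∈ Λ δ ↔ m δ ≤ v.1 1)) ∧ (∀ v : HexVertex, (δ : ℂ) * hexCenter v ∈ Metric.ball (D'.pt 1) ρ → (v ∈ Λ δ ↔ m' δ ≤ v.1 1))) → (∀ K : Set ℂ, IsCompact K → K ⊆ D.carrier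 → ∀ᶠ δ : ℝ in 𝓝[>] 0, ∀ v : HexVertex, (δ : ℂ) * hexCenter v ∈ K → v ∈ Λ δ) → Tendsto (fun δ : ℝ => (δ : ℂ) * hexMidpoint (a δ)) (𝓝[>] 0) (𝓝 (D.pt 0)) → Tendsto (fun δ : ℝ => (δ : ℂ) * hexMidpoint (b δ)) (𝓝[>] 0) (𝓝 (D.pt 1)) → Tendsto (fun δ : ℝ => (δ : ℂ) * hexMidpoint (b' δ)) (𝓝[>] 0) (𝓝 (D'.pt 1)) → Tendsto (fun x => ‖Φ x‖) (𝓝[D.carrier] (D.pt 0)) Filter.atTop → Φ.HasBoundaryValue (D.pt 1) 0 → ContinuousOn L D.carrier → (∀ z ∈ D.carrier, Complex.exp (L z) = deriv Φ z) → Tendsto L (𝓝[D.carrier] (D.pt 1)) (𝓝 Lb) → Tendsto L (𝓝[D.carrier] (D'.pt 1)) (𝓝 Lb') → Tendsto (fun δ : ℝ => ‖hexParafermionicObservable (Λ δ) (a δ) hexCriticalFugacity (5 / 8) (b' δ) / hexParafermionicObservable (Λ δ) (a δ) hexCriticalFugacity (5 / 8) (b δ)‖) (𝓝[>] 0) (𝓝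 (Real.exp ((5 / 8) * (Lb' - Lb).re))))
    (hT : ∀ ε : ℝ, 0 < ε → ∃ K : ℝ, 0 < K ∧ ∀ (n : ℕ), 1 ≤ n → ∀ (Λ B : Finset HexVertex)
    (s t : Sym2 HexVertex), s ∈ hexDomainBoundary Λ → t ∈ hexDomainBoundary Λ → s ≠ t →
    dist (hexMidpoint s) (hexMidpoint t) ≤ n → (hexMidpoint t).im = (hexMidpoint s).im →
    (∀ v ∈ Λ, (hexMidpoint s).im < (hexCenter v).im) →
    (∀ v : HexVertex, v ∈ B ↔ ((hexMidpoint s).im < (hexCenter v).im ∧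
      dist (hexCenter v) (hexMidpoint s) ≤ 2 * K * n)) →
    (∑ γ : HexMidEdgeSAW Λ s t, if ∃ v ∈ γ.verts, K * n ≤ dist (hexCenter v) (hexMidpoint s)
      then hexCriticalFugacity ^ γ.length else 0) ≤
    ε * ∑ γ : HexMidEdgeSAW B s t, hexCriticalFugacity ^ γ.length)
    (hU : ∀ (D : DobrushinDomain) (ρ : ℝ) (a b : ℝ → HexVertex),
      (0 < ρ ∧ (D.pt 1).im = (D.pt 0).im ∧ D.carrier ⊆ {z : ℂ | (D.pt 0).im < z.im} ∧
      D.carrier ∩ ball (D.pt 0) ρ = {z : ℂ | (D.pt 0).im < z.im} ∩ ball (D.pt 0) ρ ∧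
      D.carrier ∩ ball (D.pt 1) ρ = {z : ℂ | (D.pt 1).im < z.im} ∩ ball (D.pt 1) ρ) →
      (IsEmbEndpointApprox hexGraph hexCenter D a b ∧ ∀ᶠ δ : ℝ in 𝓝[>] 0,
      (∃ u : HexVertex, hexGraph.Adj (a δ) u ∧ ((δ : ℂ) * hexCenter u).im ≤ (D.pt 0).im) ∧
      (∃ u : HexVertex, hexGraph.Adj (b δ) u ∧ ((δ : ℂ) * hexCenter u).im ≤ (D.pt 1).im)) →
      ∀ ε η : ℝ, 0 < ε → 0 < η → ∃ θ : ℝ, 0 < θ ∧ ∀ᶠ δ : ℝ in 𝓝[>] 0,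
        hexSAWLaw D.carrier δ (a δ) (b δ) {γ | γ.curve ∉ CurveClass.modulusClass ε θ} ≤
          ENNReal.ofReal η)
    (hE : (∀ (D : DobrushinDomain) (ρ : ℝ) (a b : ℝ → HexVertex),
      (0 < ρ ∧ (D.pt 1).im = (D.pt 0).im ∧ D.carrier ⊆ {z : ℂ | (D.pt 0).im < z.im} ∧
        D.carrier ∩ ball (D.pt 0) ρ = {z : ℂ | (D.pt 0).im < z.im} ∩ ball (D.pt 0) ρ ∧
        D.carrier ∩ ball (D.pt 1) ρ = {z : ℂ | (D.pt 1).im < z.im} ∩ ball (D.pt 1) ρ) →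
      (IsEmbEndpointApprox hexGraph hexCenter D a b ∧ ∀ᶠ δ : ℝ in 𝓝[>] 0,
        (∃ u : HexVertex, hexGraph.Adj (a δ) u ∧ ((δ : ℂ) * hexCenter u).im ≤ (D.pt 0).im) ∧
        (∃ u : HexVertex, hexGraph.Adj (b δ) u ∧ ((δ : ℂ) * hexCenter u).im ≤ (D.pt 1).im)) →
      ConvergesInLawToSLE ((8 : ℝ≥0) / 3) D
        (fun δ (γ : HexDomainSAW D.carrier δ (a δ) (b δ)) => γ.curve)
        (fun δ => hexSAWLaw D.carrier δ (a δ) (b δ))) →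
      Summit.CriticalPhenomena.SAWScalingLimit.Theses.SAWHexUniversality.HexConjecture) :
    Summit.CriticalPhenomena.SAWScalingLimit.Theses.SAWHexUniversality.HexConjecture :=
  hE (floorConvergence_of_boundaryEstimates hF hT hU)

/-- The same composition for the payload route's decl `SAWDevelopingMap.HexConjecture` (identical body). [folklore] -/
theorem hexConjecture_of_boundaryEstimates'
    (hF : ∀ (D D' : DobrushinDomain) (ρ : ℝ) (Λ : ℝ → Finset HexVertex) (m₀ m m' : ℝ → ℤ) (a b b' : ℝ → Sym2 HexVertex) (Φ : ConformalEquiv D.carrier UpperHalfPlane.upperHalfPlaneSet) (L : ℂ → ℂ) (Lb Lb' : ℂ), D'.carrier = D.carrier → D'.pt 0 = D.pt 0 → 0 < ρ → D.carrier ∩ Metric.ball (D.pt 0) ρ = {z : ℂ | (D.pt 0).im < z.im} ∩ Metric.ball (D.pt 0) ρ → D.carrier ∩ Metric.ball (D.pt 1) ρ = {z : ℂ | (D.pt 1).im < z.im} ∩ Metric.ball (D.pt 1) ρ → D.carrier ∩ Metric.ball (D'.pt 1) ρ = {z : ℂ | (D'.pt 1).im < z.im} ∩ Metric.ball (D'.pt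 1) ρ → (∀ᶠ δ : ℝ in 𝓝[>] 0, hexDomainSimplyConnected (Λ δ) ∧ a δ ∈ hexDomainBoundary (Λ δ) ∧ b δ ∈ hexDomainBoundary (Λ δ) ∧ b' δ ∈ hexDomainBoundary (Λ δ) ∧ Nonempty (HexMidEdgeSAW (Λ δ) (a δ) (b δ)) ∧ Nonempty (HexMidEdgeSAW (Λ δ) (a δ) (b' δ)) ∧ (hexGraph.induce (↑(Λ δ) : Set HexVertex)).Preconnected ∧ (∀ v ∈ Λ δ, (δ : ℂ) * hexCenter v ∈ D.carrier) ∧ (∀ v : HexVertex, (δ : ℂ) * hexCenter v ∈ Metric.ball (D.pt 0) ρ → (v ∈ Λ δ ↔ m₀ δ ≤ v.1 1)) ∧ (∀ v : HexVertex, (δ : ℂ) * hexCenter v ∈ Metric.ball (D.pt 1) ρ → (v ∈ Λ δ ↔ m δ ≤ v.1 1)) ∧ (∀ v : HexVertex, (δ : ℂ) * hexCenter v ∈ Metric.ball (D'.pt 1) ρ → (v ∈ Λ δ ↔ m' δ ≤ v.1 1))) → (∀ K : Set ℂ, IsCompact K → K ⊆ D.carrier → ∀ᶠ δ : ℝ in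 𝓝[>] 0, ∀ v : HexVertex, (δ : ℂ) * hexCenter v ∈ K → v ∈ Λ δ) → Tendsto (fun δ : ℝ => (δ : ℂ) * hexMidpoint (a δ)) (𝓝[>] 0) (𝓝 (D.pt 0)) → Tendsto (fun δ : ℝ => (δ : ℂ) * hexMidpoint (b δ)) (𝓝[>] 0) (𝓝 (D.pt 1)) → Tendsto (fun δ : ℝ => (δ : ℂ) * hexMidpoint (b' δ)) (𝓝[>] 0) (𝓝 (D'.pt 1)) → Tendsto (fun x => ‖Φ x‖) (𝓝[D.carrier] (D.pt 0)) Filter.atTop → Φ.HasBoundaryValue (D.pt 1) 0 → ContinuousOn L D.carrier → (∀ z ∈ D.carrier, Complex.exp (L z) = deriv Φ z) → Tendsto L (𝓝[D.carrier] (D.pt 1)) (𝓝 Lb) → Tendsto L (𝓝[D.carrier] (D'.pt 1)) (𝓝 Lb') → Tendsto (fun δ : ℝ => ‖hexParafermionicObservable (Λ δ) (a δ) hexCriticalFugacity (5 / 8) (b' δ) / hexParafermionicObservable (Λ δ) (a δ) hexCriticalFugacity (5 / 8) (b δ)‖) (𝓝[>] 0) (𝓝 (Real.exp ((5 / 8)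 * (Lb' - Lb).re))))
    (hT : ∀ ε : ℝ, 0 < ε → ∃ K : ℝ, 0 < K ∧ ∀ (n : ℕ), 1 ≤ n → ∀ (Λ B : Finset HexVertex)
    (s t : Sym2 HexVertex), s ∈ hexDomainBoundary Λ → t ∈ hexDomainBoundary Λ → s ≠ t →
    dist (hexMidpoint s) (hexMidpoint t) ≤ n → (hexMidpoint t).im = (hexMidpoint s).im →
    (∀ v ∈ Λ, (hexMidpoint s).im < (hexCenter v).im) →
    (∀ v : HexVertex, v ∈ B ↔ ((hexMidpoint s).im < (hexCenter v).im ∧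
      dist (hexCenter v) (hexMidpoint s) ≤ 2 * K * n)) →
    (∑ γ : HexMidEdgeSAW Λ s t, if ∃ v ∈ γ.verts, K * n ≤ dist (hexCenter v) (hexMidpoint s)
      then hexCriticalFugacity ^ γ.length else 0) ≤
    ε * ∑ γ : HexMidEdgeSAW B s t, hexCriticalFugacity ^ γ.length)
    (hU : ∀ (D : DobrushinDomain) (ρ : ℝ) (a b : ℝ → HexVertex),
      (0 < ρ ∧ (D.pt 1).im = (D.pt 0).im ∧ D.carrier ⊆ {z : ℂ | (D.pt 0).im < z.im} ∧
      D.carrier ∩ ball (D.pt 0) ρ = {z : ℂ | (D.pt 0).im < z.im} ∩ ball (D.pt 0) ρ ∧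
      D.carrier ∩ ball (D.pt 1) ρ = {z : ℂ | (D.pt 1).im < z.im} ∩ ball (D.pt 1) ρ) →
      (IsEmbEndpointApprox hexGraph hexCenter D a b ∧ ∀ᶠ δ : ℝ in 𝓝[>] 0,
      (∃ u : HexVertex, hexGraph.Adj (a δ) u ∧ ((δ : ℂ) * hexCenter u).im ≤ (D.pt 0).im) ∧
      (∃ u : HexVertex, hexGraph.Adj (b δ) u ∧ ((δ : ℂ) * hexCenter u).im ≤ (D.pt 1).im)) →
      ∀ ε η : ℝ, 0 < ε → 0 < η → ∃ θ : ℝ, 0 < θ ∧ ∀ᶠ δ : ℝ in 𝓝[>] 0,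
        hexSAWLaw D.carrier δ (a δ) (b δ) {γ | γ.curve ∉ CurveClass.modulusClass ε θ} ≤
          ENNReal.ofReal η)
    (hE : (∀ (D : DobrushinDomain) (ρ : ℝ) (a b : ℝ → HexVertex),
      (0 < ρ ∧ (D.pt 1).im = (D.pt 0).im ∧ D.carrier ⊆ {z : ℂ | (D.pt 0).im < z.im} ∧
        D.carrier ∩ ball (D.pt 0) ρ = {z : ℂ | (D.pt 0).im < z.im} ∩ ball (D.pt 0) ρ ∧
        D.carrier ∩ ball (D.pt 1) ρ = {z : ℂ | (D.pt 1).im < z.im} ∩ ball (D.pt 1) ρ) →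
      (IsEmbEndpointApprox hexGraph hexCenter D a b ∧ ∀ᶠ δ : ℝ in 𝓝[>] 0,
        (∃ u : HexVertex, hexGraph.Adj (a δ) u ∧ ((δ : ℂ) * hexCenter u).im ≤ (D.pt 0).im) ∧
        (∃ u : HexVertex, hexGraph.Adj (b δ) u ∧ ((δ : ℂ) * hexCenter u).im ≤ (D.pt 1).im)) →
      ConvergesInLawToSLE ((8 : ℝ≥0) / 3) D
        (fun δ (γ : HexDomainSAW D.carrier δ (a δ) (b δ)) => γ.curve)
        (fun δ => hexSAWLaw D.carrier δ (a δ) (b δ))) →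
      Summit.CriticalPhenomena.SAWScalingLimit.Theses.SAWHexUniversality.HexConjecture) :
    Summit.CriticalPhenomena.SAWScalingLimit.Theses.SAWDevelopingMap.HexConjecture :=
  hE (floorConvergence_of_boundaryEstimates hF hT hU)

/-- **Crux stmt-0808 as an ASSEMBLY over existing / recommended items**: DCS Conjecture 2 in its repaired form
(`HexObservableLimitR`, item stmt-CriticalPhenomena-14003) + half-plane arch tightness + uniform injectivity modulus (crux-10472's
registered stubs, items-to-file) + boundary universality (E) ⟹ DCS Conjecture 1 as typed.  Composition of
`floorRatioModulus_of_hexObservableLimit` (p117152), `hexObservableLimitR_iff_hexObservableLimit` (p116148) and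
`hexConjecture_of_boundaryEstimates`. [cite: DuminilCopinSmirnov2012, Conjecture 2 (arXiv:1007.0575 p. 7), as hypothesis] -/
theorem hexConjecture_of_items
    (hO : Summit.CriticalPhenomena.SAWScalingLimit.Theses.SAWDefectDecoherence.HexObservableLimitR)
    (hT : ∀ ε : ℝ, 0 < ε → ∃ K : ℝ, 0 < K ∧ ∀ (n : ℕ), 1 ≤ n → ∀ (Λ B : Finset HexVertex)
    (s t : Sym2 HexVertex), s ∈ hexDomainBoundary Λ → t ∈ hexDomainBoundary Λ → s ≠ t →
    dist (hexMidpoint s) (hexMidpoint t) ≤ n → (hexMidpoint t).im = (hexMidpoint s).im →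
    (∀ v ∈ Λ, (hexMidpoint s).im < (hexCenter v).im) →
    (∀ v : HexVertex, v ∈ B ↔ ((hexMidpoint s).im < (hexCenter v).im ∧
      dist (hexCenter v) (hexMidpoint s) ≤ 2 * K * n)) →
    (∑ γ : HexMidEdgeSAW Λ s t, if ∃ v ∈ γ.verts, K * n ≤ dist (hexCenter v) (hexMidpoint s)
      then hexCriticalFugacity ^ γ.length else 0) ≤
    ε * ∑ γ : HexMidEdgeSAW B s t, hexCriticalFugacity ^ γ.length)
    (hU : ∀ (D : DobrushinDomain) (ρ : ℝ) (a b : ℝ → HexVertex),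
      (0 < ρ ∧ (D.pt 1).im = (D.pt 0).im ∧ D.carrier ⊆ {z : ℂ | (D.pt 0).im < z.im} ∧
      D.carrier ∩ ball (D.pt 0) ρ = {z : ℂ | (D.pt 0).im < z.im} ∩ ball (D.pt 0) ρ ∧
      D.carrier ∩ ball (D.pt 1) ρ = {z : ℂ | (D.pt 1).im < z.im} ∩ ball (D.pt 1) ρ) →
      (IsEmbEndpointApprox hexGraph hexCenter D a b ∧ ∀ᶠ δ : ℝ in 𝓝[>] 0,
      (∃ u : HexVertex, hexGraph.Adj (a δ) u ∧ ((δ : ℂ) * hexCenter u).im ≤ (D.pt 0).im) ∧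
      (∃ u : HexVertex, hexGraph.Adj (b δ) u ∧ ((δ : ℂ) * hexCenter u).im ≤ (D.pt 1).im)) →
      ∀ ε η : ℝ, 0 < ε → 0 < η → ∃ θ : ℝ, 0 < θ ∧ ∀ᶠ δ : ℝ in 𝓝[>] 0,
        hexSAWLaw D.carrier δ (a δ) (b δ) {γ | γ.curve ∉ CurveClass.modulusClass ε θ} ≤
          ENNReal.ofReal η)
    (hE : (∀ (D : DobrushinDomain) (ρ : ℝ) (a b : ℝ → HexVertex),
      (0 < ρ ∧ (D.pt 1).im = (D.pt 0).im ∧ D.carrier ⊆ {z : ℂ | (D.pt 0).im < z.im} ∧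
        D.carrier ∩ ball (D.pt 0) ρ = {z : ℂ | (D.pt 0).im < z.im} ∩ ball (D.pt 0) ρ ∧
        D.carrier ∩ ball (D.pt 1) ρ = {z : ℂ | (D.pt 1).im < z.im} ∩ ball (D.pt 1) ρ) →
      (IsEmbEndpointApprox hexGraph hexCenter D a b ∧ ∀ᶠ δ : ℝ in 𝓝[>] 0,
        (∃ u : HexVertex, hexGraph.Adj (a δ) u ∧ ((δ : ℂ) * hexCenter u).im ≤ (D.pt 0).im) ∧
        (∃ u : HexVertex, hexGraph.Adj (b δ) u ∧ ((δ : ℂ) * hexCenter u).im ≤ (D.pt 1).im)) →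
      ConvergesInLawToSLE ((8 : ℝ≥0) / 3) D
        (fun δ (γ : HexDomainSAW D.carrier δ (a δ) (b δ)) => γ.curve)
        (fun δ => hexSAWLaw D.carrier δ (a δ) (b δ))) →
      Summit.CriticalPhenomena.SAWScalingLimit.Theses.SAWHexUniversality.HexConjecture) :
    Summit.CriticalPhenomena.SAWScalingLimit.Theses.SAWHexUniversality.HexConjecture :=
  hexConjecture_of_boundaryEstimates
    (floorRatioModulus_of_hexObservableLimit (hexObservableLimitR_iff_hexObservableLimit.1 hO)) hT hU hE

end Summit.CriticalPhenomena.SAWScalingLimit.Theorems.HexConjecture.RootLocality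

end
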